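import Summits.SmoothPoincare4.SmoothPoincare4.Theses.WeylBudget
import Summits.SmoothPoincare4.SmoothPoincare4.Theorems.WeylBudgetCorkRegluablePscStubCorkPresentation
import Summits.SmoothPoincare4.SmoothPoincare4.Theorems.WeylBudgetCorkRegluablePscStubIsometricRegluing
import Summits.SmoothPoincare4.SmoothPoincare4.Theorems.WeylBudgetCorkRegluablePscStubIsometricTransport
import Summits.SmoothPoincare4.SmoothPoincare4.Theorems.WeylBudgetCorkRegluablePscStubTransportSymmetricGerm
import Summits.SmoothPoincare4.SmoothPoincare4.Theorems.WeylBudgetCorkRegluablePscStubSymmetricGluingOfBHData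
import Literature.Geometry.Riemannian.BaerHankeGluing
import Literature.Geometry.Riemannian.BaerHankeNormalForm
import HarnessLib

/-!
# `CorkRegluablePsc` modulo four named facts and the first-order fill-in statement 2A
(crux stmt-SmoothPoincare4-3206, route WeylBudget, line `birth`/`registered`; lead c1, 2026-08-17)

This file records in the tree the KERNEL-CHECKED reduction achieved by the line: the crux
`Summit.SmoothPoincare4.SmoothPoincare4.Theses.WeylBudget.CorkRegluablePsc` (every homotopy 4-sphere is an
ISOMETRIC cork regluing of some positive-scalar-curvature metric on `S⁴`) follows from

* `Θ₄ = 0` — `Literature.Topology.FourManifolds.isHCobordant_sphere_of_homotopySphere_four` (Wall 1964 Thm. 2 /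
  Kervaire–Milnor 1963), named fact;
* the involutive cork theorem — `Literature.Topology.FourManifolds.matveyev1996_involutiveDecomposition`
  (Curtis–Freedman–Hsiang–Stong 1996, Matveyev 1996, Kirby 1996 Addendum (D)), named fact;
* Bär–Hanke 2023 Prop. 28 — `Literature.Geometry.Riemannian.BarHanke2023_prop28_meanCurvatureIncrease`, named fact;
* Bär–Hanke 2023 Thm. 27 (with Def. 21) — `Literature.Geometry.Riemannian.BarHanke2023_thm27_umbilicNormalForm`,
  named fact;
* **2A (simultaneous Bär–Hanke data)** — for every involutive cork presentation `S⁴ = C ∪_φ W`,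
  `Σ = C ∪_(φ∘τ) W`: ONE pair of Riemannian PSC metrics `g_C` on `C`, `g_W` on `W` (smooth outward unit normals)
  whose induced boundary forms agree under `φ` AND under `φ ∘ τ` and whose outward mean curvatures satisfy
  `H_C z + H_W (φ z) ≥ 0` and `H_C z + H_W (φ (τ z)) ≥ 0` — each block verbatim the hypothesis of
  `Literature.Geometry.Riemannian.BaerHankePscGluing.dim_four` for the respective gluing.  This is the open
  geometric content of the crux (it implies PSC on every homotopy 4-sphere through `BaerHankePscGluing`);
  hypothesis `h2A` below, stated exactly as the registered stub `stub_simultaneousBHData` of the line.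

Everything else is PROVED in the tree and merely assembled here: `stub_corkPresentation_of_facts` (p149863),
`stub_symmetricGluingOfBHData_of_bhFacts` (2B: Bär–Hanke Prop. 28 + Thm. 27 ⇒ a PSC metric on some `P = C ∪_φ W`
with an isometric side-preserving involution `T ⊇ τ` near the seam — umbilic `C₀`-normal forms glued back to
back, `stub_collarGluing` p160756), `stub_transportSymmetricGerm` (p155387), `stub_isometricRegluing` (p149812),
`stub_isometricTransport` (p147438).  CONDITIONAL result: the item closes only when the four facts are discharged
and 2A is proved.
-/

noncomputable section

-- the prescribed namespace `Summit.<P>.<Sub>.…` duplicates `SmoothPoincare4` (P = Sub)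
set_option linter.dupNamespace false

open scoped Manifold ContDiff Topology

namespace Summit.SmoothPoincare4.SmoothPoincare4.Theorems

/-- **`CorkRegluablePsc` from `Θ₄ = 0`, the involutive cork theorem, Bär–Hanke 2023 Prop. 28 / Thm. 27, and
the simultaneous Bär–Hanke data 2A.**  Present `Σ` as an involutive cork twist of `S⁴` (cork theorem + `Θ₄ = 0`);
take the 2A pair `(g_C, g_W)`; glue it τ-symmetrically on some `P = C ∪_φ W` (Bär–Hanke normal forms, collar
gluing); move `(jC, jW, g, U, T)` to the standard `S⁴` (gluing uniqueness); cut `(S⁴, g)` along the seam and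
reglue by `T` to get `X = C ∪_(φ∘τ) W` with the same piece metrics; move to `S.carrier` (gluing uniqueness).
CONDITIONAL on the four named facts and on 2A (hypotheses). [cite: BarHanke2023, §3 Thm. 27, Prop. 28, §4.4 Thm. 42; Matveyev1996, Theorem; KervaireMilnorAnnals1963, table p. 504] -/
theorem corkRegluablePsc_of_facts :
    Literature.Topology.FourManifolds.isHCobordant_sphere_of_homotopySphere_four →
    Literature.Topology.FourManifolds.matveyev1996_involutiveDecomposition →
    Literature.Geometry.Riemannian.BarHanke2023_prop28_meanCurvatureIncrease →
    Literature.Geometry.Riemannian.BarHanke2023_thm27_umbilicNormalForm →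
    (∀ (C : Type) [TopologicalSpace C] [T2Space C] [SecondCountableTopology C] [ChartedSpace (EuclideanHalfSpace 4) C] [IsManifold (𝓡∂ 4) ∞ C] [CompactSpace C] [ContractibleSpace C] (bC : Literature.Topology.FourManifolds.BoundaryData (𝓡∂ 4) C (𝓡 3)) (W : Type) [TopologicalSpace W] [T2Space W] [SecondCountableTopology W] [ChartedSpace (EuclideanHalfSpace 4) W] [IsManifold (𝓡∂ 4) ∞ W] [CompactSpace W] (bW : Literature.Topology.FourManifolds.BoundaryData (𝓡∂ 4) W (𝓡 3)) (φ : bC.carrier ≃ₘ⟮𝓡 3, 𝓡 3⟯ bW.carrier) (τ : bC.carrier ≃ₘ⟮𝓡 3, 𝓡 3⟯ bC.carrier), Function.Involutive τ → Literature.Topology.FourManifolds.IsBoundaryGluing bC bW φ (𝓡 4) (Metric.sphere (0 : EuclideanSpace ℝ (Fin 5)) 1) → (∀ S : Literature.Topology.FourManifolds.HomotopySphere 4, Literature.Topology.FourManifolds.IsBoundaryGluing bC bW (τ.trans φ) (𝓡 4) S.carrier → ∃ (gC : Literature.Geometry.Lorentzian.PseudoRiemannianMetric (𝓡∂ 4)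 ∞ (EuclideanSpace ℝ (Fin 4)) (TangentSpace (𝓡∂ 4) : C → Type _)) (_ : gC.HasLeviCivita) (hfC : gC.IsSpacelikeImmersion (𝓡 3) bC.incl) (νC : Literature.Geometry.Lorentzian.NormalField (𝓡∂ 4) bC.incl) (gW : Literature.Geometry.Lorentzian.PseudoRiemannianMetric (𝓡∂ 4) ∞ (EuclideanSpace ℝ (Fin 4)) (TangentSpace (𝓡∂ 4) : W → Type _)) (_ : gW.HasLeviCivita) (hfW : gW.IsSpacelikeImmersion (𝓡 3) bW.incl) (νW : Literature.Geometry.Lorentzian.NormalField (𝓡∂ 4) bW.incl), (gC.IsRiemannian ∧ (∀ x, 0 < gC.scalarCurvature x) ∧ gC.IsUnitNormal (𝓡 3) bC.incl νC 1 ∧ ContMDiff (𝓡 3) (𝓡∂ 4).tangent ∞ (fun z ↦ (Bundle.TotalSpace.mk' (EuclideanSpace ℝ (Fin 4)) (bC.incl z) (νC z) : TangentBundle (𝓡∂ 4) C)) ∧ (∀ z, (show EuclideanSpace ℝ (Fin 4) from νC z) 0 < 0)) ∧ (gW.IsRiemannian ∧ (∀ x, 0 < gW.scalarCurvature x) ∧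 gW.IsUnitNormal (𝓡 3) bW.incl νW 1 ∧ ContMDiff (𝓡 3) (𝓡∂ 4).tangent ∞ (fun w ↦ (Bundle.TotalSpace.mk' (EuclideanSpace ℝ (Fin 4)) (bW.incl w) (νW w) : TangentBundle (𝓡∂ 4) W)) ∧ (∀ w, (show EuclideanSpace ℝ (Fin 4) from νW w) 0 < 0)) ∧ (∀ z, Literature.Geometry.Lorentzian.pullbackBilin (I := 𝓡∂ 4) (I' := 𝓡 3) bC.incl gC.val z = Literature.Geometry.Lorentzian.pullbackBilin (I := 𝓡∂ 4) (I' := 𝓡 3) (bW.incl ∘ φ) gW.val z) ∧ (∀ z, Literature.Geometry.Lorentzian.pullbackBilin (I := 𝓡∂ 4) (I' := 𝓡 3) bC.incl gC.val z = Literature.Geometry.Lorentzian.pullbackBilin (I := 𝓡∂ 4) (I' := 𝓡 3) (bW.incl ∘ φ ∘ τ) gW.val z) ∧ (∀ z, 0 ≤ gC.meanCurvature bC.incl Literature.Geometry.Lorentzian.PseudoRiemannianMetric.contMDiff_pullbackBilin_holds hfC νC z + gW.meanCurvature bW.incl Literature.Geometry.Lorentzian.PseudoRiemannianMetric.contMDiff_pullbackBilin_holds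 hfW νW (φ z)) ∧ (∀ z, 0 ≤ gC.meanCurvature bC.incl Literature.Geometry.Lorentzian.PseudoRiemannianMetric.contMDiff_pullbackBilin_holds hfC νC z + gW.meanCurvature bW.incl Literature.Geometry.Lorentzian.PseudoRiemannianMetric.contMDiff_pullbackBilin_holds hfW νW (φ (τ z))))) → Summit.SmoothPoincare4.SmoothPoincare4.Theses.WeylBudget.CorkRegluablePsc := by
  intro hΘ hM h28 h27 h2A S
  -- the involutive cork presentation `S⁴ = C ∪_φ W`, `Σ = C ∪_(φ∘τ) W`
  obtain ⟨C, instTC, instT2C, instSCC, instChC, instMC, instCompC, instContrC, bC, W, instTW, instT2W,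
    instSCW, instChW, instMW, instCompW, bW, φ, τ, hτ, hS4, hSig⟩ :=
    stub_corkPresentation_of_facts hΘ hM S
  -- 2A: the simultaneous Bär–Hanke data
  obtain ⟨gC, hLC, hfC, νC, gW, hLW, hfW, νW, hC, hW, hmet, hmetτ, hH, hHτ⟩ :=
    h2A C bC W bW φ τ hτ hS4 S hSig
  -- 2B: τ-symmetric PSC metric on some gluing `P`
  obtain ⟨P, _, _, _, _, _, jCP, jWP, hwit, gP, UP, TP, hsym⟩ :=
    stub_symmetricGluingOfBHData_of_bhFacts h28 h27 C bC W bW φ τ hτ gC hfC νC gW hfW νW hC hW hmet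
      hmetτ hH hHτ
  -- 2T: transport to the standard sphere
  obtain ⟨jC, jW, ⟨hjC, hjW, hcov, hseam⟩, g, U, T, hg, hLCscal, hU, hYU, hT, hTU, hTT, hTside, hTτ,
    hTiso⟩ := stub_transportSymmetricGerm C bC W bW φ τ P jCP jWP gP UP TP hτ hwit hsym hS4
  -- 3: the isometric regluing `X = C ∪_(φ∘τ) W` of `(S⁴, g)`
  obtain ⟨X, instTX, instT2X, instSCX, instChX, instMX, kC₀, kW₀, γ₀, hkC₀, hkW₀, hcov₀, hseam₀, hγ₀,
    hpC₀, hpW₀⟩ :=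
    stub_isometricRegluing C bC W bW φ τ jC jW g U T hτ hjC hjW hcov hseam hg hU hYU hT hTU hTT hTside
      hTτ hTiso
  -- 4: transport to the given carrier `S.carrier`
  obtain ⟨kC, kW, γ, hkC, hkW, hkcov, hkseam, hγ, hpC, hpW⟩ :=
    stub_isometricTransport C bC W bW (τ.trans φ) X S.carrier kC₀ kW₀ γ₀ hkC₀ hkW₀ hcov₀ hseam₀ hγ₀ hSig
  obtain ⟨hLC', hscal⟩ := hLCscal
  refine ⟨C, instTC, instChC, instMC, W, instTW, instChW, instMW, jC, jW, kC, kW, g, γ, instCompC,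
    instContrC, hjC, hjW, hcov, ?_, hkC, hkW, hkcov, ?_, ?_, ?_, hg, hγ, hLC', hscal⟩
  · -- seam points of the `S⁴`-gluing are boundary points of `C`
    intro c v hcv
    obtain ⟨z, hz, -⟩ := (hseam c v).1 hcv
    have hb : bC.incl z ∈ (𝓡∂ 4).boundary C := by
      rw [← bC.range_incl]; exact Set.mem_range_self z
    rw [hz]; exact hb
  · -- seam points of the `Σ`-gluing are boundary points of `C`
    intro c v hcv
    obtain ⟨z, hz, -⟩ := (hkseam c v).1 hcv
    have hb : bC.incl z ∈ (𝓡∂ 4).boundary C := by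
      rw [← bC.range_incl]; exact Set.mem_range_self z
    rw [hz]; exact hb
  · intro c
    exact (hpC₀ c).trans (hpC c).symm
  · intro w
    exact (hpW₀ w).trans (hpW w).symm

end Summit.SmoothPoincare4.SmoothPoincare4.Theorems

end
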